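import Mathlib.RingTheory.IntegralDomain
import Literature.RepresentationTheory.FiniteGroups.GL2ModularPrincipalSeriesInvariants
import HarnessLib

/-!
# The intertwining operator `T : 𝓑(χ₁, χ₂) → 𝓑(χ₂, χ₁)`, `(T f)(x) = Σ_{t ∈ F} f(w u(t) x)`, of the
# principal series of `GL₂(F)` (`F` finite): `T f₁ = f_w'` and, for `χ₁ ≠ χ₂` and `#F = 0` in `k`, `T f_w = 0`

Topic `Literature/RepresentationTheory/FiniteGroups`, namespace `Literature.RepresentationTheory.FiniteGroups.GL2`
(sequel of `GL2ModularPrincipalSeriesInvariants`).  DEFINITIONS (`intertwining`, `intertwiningMap`,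
`kerIntertwining`, `rangeIntertwining`) + API (reviewed kind); no named fact, no instance, no notation, no `sorry`.
(Coefficient note: the defining file `GL2ModularPrincipalSeries` now allows any commutative coefficient ring — the integral structure `Fun_R(Ind(χ₁ ⊗ χ₂))` of `GL2ModularPrincipalSeriesBruhatBasis` / `…Reduction` —; this file keeps `k` a field.)

Source: D. Bump, *Automorphic Forms and Representations* [Bump1997], §4.1 Lemma 4.1.1 / Prop. 4.1.2 (held,
p0399–p0401): `dim Hom_{GL(2,F)}(𝓑(χ₁, χ₂), 𝓑(μ₁, μ₂)) = e₁ + e₂` with `e₂ = 1` iff `χ₁ = μ₂, χ₂ = μ₁` — i.e.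
for `χ₁ ≠ χ₂` there is, up to scalars, exactly one intertwining operator `𝓑(χ₁, χ₂) → 𝓑(χ₂, χ₁)`, supported
on the big double coset `B w₀ B` (Bump's `Δ₂`).  Written as a right-`G`-equivariant operator on functions it is
the finite-field avatar of the standard intertwining integral `(M f)(g) = ∫_N f(w n g) dn` (Bump §4.5 (5.21) for
the local field case):

  `(T f)(x) := Σ_{t ∈ F} f(w · u(t) · x)`,  `u(t) = (1 t; 0 1)`,  `w = (0 1; 1 0)`.

Everything here is elementary bookkeeping with the Bruhat decomposition (Eq. (1.7)): `w u(t) b = diag(b₁₁,b₀₀) ·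
w u((b₀₁ + t b₁₁)/b₀₀)` shows `T f ∈ 𝓑(χ₂, χ₁)` after the affine change of variables in `t`; right translations
commute with `T`.  The two evaluations are the heart of the mod-`p` theory: `T f₁ = f_w'` (the big-cell function
of `𝓑(χ₂, χ₁)`), while `T f_w` has `(T f_w)(1) = #F · 1` and `(T f_w)(w) = χ₁(−1) Σ_{t ∈ Fˣ} (χ₂χ₁⁻¹)(t)`, so
**`T f_w = 0` when `χ₁ ≠ χ₂` and `#F = 0` in `k`** (characteristic `p`, `F = 𝔽_q`): `T` is neither injective nor
zero, which in the sequel `GL2ModularPrincipalSeriesLengthTwo` yields `ker T = soc 𝓑(χ₁,χ₂) = Sym^r ⊗ χ₁∘det`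
and `im T = soc 𝓑(χ₂,χ₁) = Sym^{p−1−r} ⊗ χ₂∘det` (the two Jordan–Hölder factors of [EmertonGeeSavitt2015] §3.2).

## What is defined / proved (`F : Type` a finite field with decidable equality, `k` a field)

* `weyl_mul_upperUnip_mul_borel` — `w u(t) b = diag(b₁₁, b₀₀) · w u((b₀₁ + t b₁₁)/b₀₀)` for `b ∈ B`;
* `intertwining χ₁ χ₂ : 𝓑(χ₁, χ₂) →ₗ[k] 𝓑(χ₂, χ₁)`, `intertwining_principalSeriesRep` (equivariance),
  `intertwiningMap` (as a Mathlib `Representation.IntertwiningMap`), `intertwining_upper_invariant`;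
* `intertwining_deltaBorel : T f₁ = f_w'`; `deltaBigCell_apply_lowerUnip`;
  `intertwining_deltaBigCell : χ₁ ≠ χ₂ → (#F : k) = 0 → T f_w = 0` (orthogonality `Σ_{Fˣ} (χ₂χ₁⁻¹) = 0`,
  Mathlib's `sum_hom_units_eq_zero`);
* `kerIntertwining χ₁ χ₂`, `rangeIntertwining χ₁ χ₂` — `ker T` and `im T` as subrepresentations.
-/

noncomputable section

namespace Literature.RepresentationTheory.FiniteGroups

namespace GL2

open Matrix

section Intertwiner

variable {F : Type} [Field F] [Fintype F] [DecidableEq F] {k : Type*} [Field k] (χ₁ χ₂ : Fˣ →* kˣ)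

omit [Fintype F] [DecidableEq F] in
/-- Moving `w u(t)` past a Borel element: `w u(t) b = diag(b₁₁, b₀₀) · w u((b₀₁ + t b₁₁)/b₀₀)`.
[cite: Bump1997, §4.1 Eq. (1.7)] -/
theorem weyl_mul_upperUnip_mul_borel (b : borel F) (t : F) :
    weyl F * upperUnip F t * (b : GL (Fin 2) F) =
      diagElt F (borelSnd b) (borelFst b) * (weyl F * upperUnip F
        ((((b : GL (Fin 2) F) : Matrix (Fin 2) (Fin 2) F) 0 1 +
          t * ((b : GL (Fin 2) F) : Matrix (Fin 2) (Fin 2) F) 1 1) /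
          ((b : GL (Fin 2) F) : Matrix (Fin 2) (Fin 2) F) 0 0)) := by
  have h00 := apply_zero_zero_ne_zero_of_mem_borel b.2
  have h10 : ((b : GL (Fin 2) F) : Matrix (Fin 2) (Fin 2) F) 1 0 = 0 := (mem_borel_iff _).mp b.2
  refine Matrix.GeneralLinearGroup.ext fun i j => ?_
  simp only [Matrix.GeneralLinearGroup.coe_mul, coe_weyl, coe_upperUnip, coe_diagElt, coe_borelFst,
    coe_borelSnd]
  fin_cases i <;> fin_cases j <;> simp [Matrix.mul_apply, Fin.sum_univ_two, h10]
  field_simp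

/-- **The intertwining operator** `T : 𝓑(χ₁, χ₂) → 𝓑(χ₂, χ₁)`, `(T f)(x) = Σ_{t ∈ F} f(w u(t) x)`
(the finite-field shadow of `M(s) : 𝓑(χ₁,χ₂) → 𝓑(χ₂,χ₁)`, `∫_N f(w n g) dn`). [cite: Bump1997, §4.1 Lemma 4.1.1] -/
def intertwining :
    Representation.coindV (borel F).subtype (scalarRep (borelCharacter F χ₁ χ₂)) →ₗ[k]
      Representation.coindV (borel F).subtype (scalarRep (borelCharacter F χ₂ χ₁)) where
  toFun f := ⟨fun x => ∑ t : F, (f : GL (Fin 2) F → k) (weyl F * upperUnip F t * x), by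
    rw [mem_principalSeriesRep_iff]
    intro b x
    have h00 := apply_zero_zero_ne_zero_of_mem_borel b.2
    have h11 := apply_one_one_ne_zero_of_mem_borel b.2
    -- the affine change of variables `t ↦ (b₀₁ + t b₁₁)/b₀₀`
    set e : F → F := fun t =>
      (((b : GL (Fin 2) F) : Matrix (Fin 2) (Fin 2) F) 0 1 +
        t * ((b : GL (Fin 2) F) : Matrix (Fin 2) (Fin 2) F) 1 1) /
        ((b : GL (Fin 2) F) : Matrix (Fin 2) (Fin 2) F) 0 0 with he
    have hbij : Function.Bijective e := by
      refine (Finite.injective_iff_bijective).mp fun t₁ t₂ h => ?_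
      simp only [he] at h
      rw [div_left_inj' h00, add_right_inj] at h
      exact mul_right_cancel₀ h11 h
    have hd : diagElt F (borelSnd b) (borelFst b) ∈ borel F := diagElt_mem_borel F _ _
    have key : ∀ t : F, (f : GL (Fin 2) F → k) (weyl F * upperUnip F t * ((b : GL (Fin 2) F) * x)) =
        (borelCharacter F χ₂ χ₁ b : k) * (f : GL (Fin 2) F → k) (weyl F * upperUnip F (e t) * x) := by
      intro t
      rw [← mul_assoc, weyl_mul_upperUnip_mul_borel, mul_assoc,
        apply_borel_mul χ₁ χ₂ f ⟨_, hd⟩, borelCharacter_diagElt, borelCharacter_apply, Units.val_mul,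
        Units.val_mul, mul_comm (χ₁ (borelSnd b) : k)]
    simp_rw [key, ← Finset.mul_sum]
    congr 1
    exact Function.Bijective.sum_comp hbij (fun t => (f : GL (Fin 2) F → k) (weyl F * upperUnip F t * x))⟩
  map_add' f g := by
    refine Subtype.ext (funext fun x => ?_)
    simp only [Submodule.coe_add, Pi.add_apply, Finset.sum_add_distrib]
  map_smul' c f := by
    refine Subtype.ext (funext fun x => ?_)
    simp only [Submodule.coe_smul, Pi.smul_apply, smul_eq_mul, RingHom.id_apply, Finset.mul_sum]

omit [DecidableEq F] in
/-- Unfolding lemma: `(T f)(x) = Σ_t f(w u(t) x)`. [cite: Bump1997, §4.1 Lemma 4.1.1] -/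
theorem intertwining_apply_coe
    (f : Representation.coindV (borel F).subtype (scalarRep (borelCharacter F χ₁ χ₂))) (x : GL (Fin 2) F) :
    (intertwining χ₁ χ₂ f : GL (Fin 2) F → k) x =
      ∑ t : F, (f : GL (Fin 2) F → k) (weyl F * upperUnip F t * x) := rfl

omit [DecidableEq F] in
/-- `T` is `GL₂(F)`-equivariant (it is a left convolution, the group acts on the right). [cite: Bump1997, §4.1 Lemma 4.1.1] -/
theorem intertwining_principalSeriesRep (h : GL (Fin 2) F)
    (f : Representation.coindV (borel F).subtype (scalarRep (borelCharacter F χ₁ χ₂))) :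
    intertwining χ₁ χ₂ (principalSeriesRep F χ₁ χ₂ h f) =
      principalSeriesRep F χ₂ χ₁ h (intertwining χ₁ χ₂ f) := by
  refine Subtype.ext (funext fun x => ?_)
  simp only [intertwining_apply_coe, principalSeriesRep_apply_coe, mul_assoc]

/-- `T` as a Mathlib intertwining map `𝓑(χ₁, χ₂) →_G 𝓑(χ₂, χ₁)`. [cite: Bump1997, §4.1 Lemma 4.1.1] -/
def intertwiningMap :
    (principalSeriesRep F χ₁ χ₂).IntertwiningMap (principalSeriesRep F χ₂ χ₁) :=
  LinearMap.intertwiningMap_of_isIntertwiningMap _ _ (intertwining χ₁ χ₂)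
    (fun h f => intertwining_principalSeriesRep χ₁ χ₂ h f)

omit [DecidableEq F] in
/-- `T` preserves `N`-invariance. [cite: Bump1997, §4.1 Lemma 4.1.1] -/
theorem intertwining_upper_invariant
    (f : Representation.coindV (borel F).subtype (scalarRep (borelCharacter F χ₁ χ₂)))
    (hf : ∀ t : F, principalSeriesRep F χ₁ χ₂ (upperUnip F t) f = f) (t : F) :
    principalSeriesRep F χ₂ χ₁ (upperUnip F t) (intertwining χ₁ χ₂ f) = intertwining χ₁ χ₂ f := by
  rw [← intertwining_principalSeriesRep, hf]

omit [Fintype F] [DecidableEq F] in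
/-- `w u(t) w = v(t)`. [cite: Bump1997, §4.1 Eq. (1.7)] -/
theorem weyl_mul_upperUnip_mul_weyl (t : F) : weyl F * upperUnip F t * weyl F = lowerUnip F t := by
  refine Matrix.GeneralLinearGroup.ext fun i j => ?_
  simp only [Matrix.GeneralLinearGroup.coe_mul, coe_weyl, coe_upperUnip, coe_lowerUnip]
  fin_cases i <;> fin_cases j <;> simp [Matrix.mul_apply, Fin.sum_univ_two]

omit [Fintype F] [DecidableEq F] in
/-- `w u(t) ∉ B` (it lies in the big cell). [cite: Bump1997, §4.1 Eq. (1.7)] -/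
theorem weyl_mul_upperUnip_not_mem (t : F) : weyl F * upperUnip F t ∉ borel F := by
  rw [mem_borel_iff]
  change ¬ ((weyl F : Matrix (Fin 2) (Fin 2) F) * (upperUnip F t : Matrix (Fin 2) (Fin 2) F)) 1 0 = 0
  rw [coe_weyl, coe_upperUnip]
  simp [Matrix.mul_apply, Fin.sum_univ_two]

omit [Fintype F] [DecidableEq F] in
/-- `v(t) ∈ B ↔ t = 0`. [cite: Bump1997, §4.1 Eq. (1.7)] -/
theorem lowerUnip_mem_borel_iff (t : F) : lowerUnip F t ∈ borel F ↔ t = 0 := by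
  rw [mem_borel_iff]; simp

/-- **`T f₁ = f_w'`**: the delta function at the base point goes to the big-cell function of
`𝓑(χ₂, χ₁)`. [cite: Bump1997, §4.1 Lemma 4.1.1] -/
theorem intertwining_deltaBorel : intertwining χ₁ χ₂ (deltaBorel χ₁ χ₂) = deltaBigCell χ₂ χ₁ := by
  have hinv := intertwining_upper_invariant χ₁ χ₂ (deltaBorel χ₁ χ₂)
    (principalSeriesRep_upperUnip_deltaBorel χ₁ χ₂)
  rw [eq_add_of_upper_invariant χ₂ χ₁ _ hinv]
  have h1 : (intertwining χ₁ χ₂ (deltaBorel χ₁ χ₂) : GL (Fin 2) F → k) 1 = 0 := by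
    rw [intertwining_apply_coe]
    refine Finset.sum_eq_zero fun t _ => ?_
    rw [mul_one]
    exact deltaBorel_apply_of_not_mem χ₁ χ₂ (weyl_mul_upperUnip_not_mem t)
  have hw : (intertwining χ₁ χ₂ (deltaBorel χ₁ χ₂) : GL (Fin 2) F → k) (weyl F) = 1 := by
    rw [intertwining_apply_coe, Finset.sum_eq_single_of_mem (0 : F) (Finset.mem_univ _)]
    · rw [weyl_mul_upperUnip_mul_weyl, (show lowerUnip F 0 = 1 from lowerUnip_zero), deltaBorel_apply_one]
    · intro t _ ht
      rw [weyl_mul_upperUnip_mul_weyl]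
      exact deltaBorel_apply_of_not_mem χ₁ χ₂ (fun h => ht ((lowerUnip_mem_borel_iff t).mp h))
  rw [h1, hw, zero_smul, zero_add, one_smul]

omit [Fintype F] in
/-- The value `f_w(v(t)) = χ₁(−1) · (χ₂χ₁⁻¹)(t)` for `t ≠ 0`. [cite: Bump1997, §4.1 Lemma 4.1.1] -/
theorem deltaBigCell_apply_lowerUnip {t : F} (ht : t ≠ 0) :
    (deltaBigCell χ₁ χ₂ : GL (Fin 2) F → k) (lowerUnip F t) =
      (χ₁ (-1) : k) * ((χ₂ (Units.mk0 t ht) : k) * ((χ₁ (Units.mk0 t ht) : k))⁻¹) := by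
  have h10 : (lowerUnip F t : Matrix (Fin 2) (Fin 2) F) 1 0 ≠ 0 := by simpa using ht
  rw [deltaBigCell_apply_of_ne χ₁ χ₂ h10]
  have e1 : Units.mk0 (-(lowerUnip F t : Matrix (Fin 2) (Fin 2) F).det / (lowerUnip F t : Matrix (Fin 2) (Fin 2) F) 1 0)
      (div_ne_zero (neg_ne_zero.mpr (lowerUnip F t).det_ne_zero) h10) = -1 * (Units.mk0 t ht)⁻¹ := by
    refine Units.ext ?_
    rw [Units.val_mk0, Units.val_mul, Units.val_inv_eq_inv_val, Units.val_mk0, coe_lowerUnip]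
    simp [Matrix.det_fin_two_of, div_eq_mul_inv]
  have e2 : Units.mk0 ((lowerUnip F t : Matrix (Fin 2) (Fin 2) F) 1 0) h10 = Units.mk0 t ht :=
    Units.ext (by simp)
  rw [e1, e2, map_mul, map_inv, Units.val_mul, Units.val_inv_eq_inv_val]
  ring

/-- **`T f_w = 0`** when `χ₁ ≠ χ₂` and `#F = 0` in `k` (e.g. `F = 𝔽_p ⊆ k`): `(T f_w)(1) = #F · 1 = 0` and
`(T f_w)(w) = χ₁(−1) Σ_{t ∈ Fˣ} (χ₂χ₁⁻¹)(t) = 0` (orthogonality of the nontrivial character `χ₂χ₁⁻¹`).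
[cite: Bump1997, §4.1 Lemma 4.1.1] -/
theorem intertwining_deltaBigCell (hχ : χ₁ ≠ χ₂) (hF : (Fintype.card F : k) = 0) :
    intertwining χ₁ χ₂ (deltaBigCell χ₁ χ₂) = 0 := by
  have hinv := intertwining_upper_invariant χ₁ χ₂ (deltaBigCell χ₁ χ₂)
    (principalSeriesRep_upperUnip_deltaBigCell χ₁ χ₂)
  rw [eq_add_of_upper_invariant χ₂ χ₁ _ hinv]
  have h1 : (intertwining χ₁ χ₂ (deltaBigCell χ₁ χ₂) : GL (Fin 2) F → k) 1 = 0 := by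
    rw [intertwining_apply_coe]
    have : ∀ t : F, (deltaBigCell χ₁ χ₂ : GL (Fin 2) F → k) (weyl F * upperUnip F t * 1) = 1 := by
      intro t
      rw [mul_one]
      have h10 : ((weyl F * upperUnip F t : GL (Fin 2) F) : Matrix (Fin 2) (Fin 2) F) 1 0 ≠ 0 :=
        fun h => weyl_mul_upperUnip_not_mem t ((mem_borel_iff _).mpr h)
      rw [deltaBigCell_apply_of_ne χ₁ χ₂ h10]
      have e1 : Units.mk0 (-((weyl F * upperUnip F t : GL (Fin 2) F) : Matrix (Fin 2) (Fin 2) F).det /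
          ((weyl F * upperUnip F t : GL (Fin 2) F) : Matrix (Fin 2) (Fin 2) F) 1 0)
          (div_ne_zero (neg_ne_zero.mpr (weyl F * upperUnip F t).det_ne_zero) h10) = 1 := by
        refine Units.ext ?_
        rw [Units.val_mk0, Units.val_one, Matrix.GeneralLinearGroup.coe_mul, Matrix.det_mul, coe_weyl,
          coe_upperUnip]
        simp [Matrix.det_fin_two_of, Matrix.mul_apply, Fin.sum_univ_two]
      have e2 : Units.mk0 (((weyl F * upperUnip F t : GL (Fin 2) F) : Matrix (Fin 2) (Fin 2) F) 1 0) h10 = 1 := by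
        refine Units.ext ?_
        rw [Units.val_mk0, Units.val_one, Matrix.GeneralLinearGroup.coe_mul, coe_weyl, coe_upperUnip]
        simp [Matrix.mul_apply, Fin.sum_univ_two]
      rw [e1, e2, map_one, map_one, Units.val_one, mul_one]
    simp_rw [this, Finset.sum_const, Finset.card_univ, nsmul_eq_mul, mul_one]
    exact hF
  have hw : (intertwining χ₁ χ₂ (deltaBigCell χ₁ χ₂) : GL (Fin 2) F → k) (weyl F) = 0 := by
    rw [intertwining_apply_coe]
    simp_rw [weyl_mul_upperUnip_mul_weyl]
    -- the summand vanishes at `t = 0` and equals `χ₁(-1)(χ₂χ₁⁻¹)(t)` on units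
    have h0 : (deltaBigCell χ₁ χ₂ : GL (Fin 2) F → k) (lowerUnip F 0) = 0 := by
      rw [lowerUnip_zero]; exact deltaBigCell_apply_one χ₁ χ₂
    rw [← Finset.sum_erase (Finset.univ : Finset F) (f := fun t => (deltaBigCell χ₁ χ₂ : GL (Fin 2) F → k)
      (lowerUnip F t)) h0]
    have hset : (Finset.univ : Finset F).erase 0 = Finset.univ.map ⟨(fun u : Fˣ => (u : F)), Units.val_injective⟩ := by
      ext t
      simp only [Finset.mem_erase, Finset.mem_univ, and_true, Finset.mem_map, Function.Embedding.coeFn_mk,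
        true_and]
      exact ⟨fun h => ⟨Units.mk0 t h, rfl⟩, fun ⟨u, hu⟩ => hu ▸ u.ne_zero⟩
    rw [hset, Finset.sum_map]
    simp only [Function.Embedding.coeFn_mk]
    have hval : ∀ u : Fˣ, (deltaBigCell χ₁ χ₂ : GL (Fin 2) F → k) (lowerUnip F (u : F)) =
        (χ₁ (-1) : k) * ((Units.coeHom k).comp (χ₂ * χ₁⁻¹)) u := by
      intro u
      rw [deltaBigCell_apply_lowerUnip χ₁ χ₂ u.ne_zero, Units.mk0_val]
      simp [Units.val_inv_eq_inv_val]
    simp_rw [hval, ← Finset.mul_sum]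
    have hne : (Units.coeHom k).comp (χ₂ * χ₁⁻¹) ≠ 1 := by
      intro h
      apply hχ
      ext u
      have := DFunLike.congr_fun h u
      simp only [MonoidHom.comp_apply, MonoidHom.mul_apply, MonoidHom.inv_apply, Units.coeHom_apply,
        Units.val_mul, Units.val_inv_eq_inv_val, MonoidHom.one_apply] at this
      rw [mul_inv_eq_one₀ (Units.ne_zero _)] at this
      exact this.symm
    rw [sum_hom_units_eq_zero _ hne, mul_zero]
  rw [h1, hw, zero_smul, zero_smul, add_zero]

/-- The kernel of the intertwining operator `T`, as a subrepresentation of `𝓑(χ₁, χ₂)`. [cite: Bump1997, §4.1 Lemma 4.1.1] -/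
def kerIntertwining : Subrepresentation (principalSeriesRep F χ₁ χ₂) :=
  ⟨LinearMap.ker (intertwining χ₁ χ₂), fun h v hv => by
    rw [LinearMap.mem_ker] at hv ⊢
    rw [intertwining_principalSeriesRep, hv, map_zero]⟩

/-- The image of the intertwining operator `T`, as a subrepresentation of `𝓑(χ₂, χ₁)`. [cite: Bump1997, §4.1 Lemma 4.1.1] -/
def rangeIntertwining : Subrepresentation (principalSeriesRep F χ₂ χ₁) :=
  ⟨LinearMap.range (intertwining χ₁ χ₂), by
    rintro h _ ⟨v, rfl⟩
    exact ⟨principalSeriesRep F χ₁ χ₂ h v, intertwining_principalSeriesRep χ₁ χ₂ h v⟩⟩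

omit [DecidableEq F] in
/-- Unfolding lemma. [cite: Bump1997, §4.1 Lemma 4.1.1] -/
theorem kerIntertwining_toSubmodule :
    (kerIntertwining χ₁ χ₂).toSubmodule = LinearMap.ker (intertwining χ₁ χ₂) := rfl

omit [DecidableEq F] in
/-- Unfolding lemma. [cite: Bump1997, §4.1 Lemma 4.1.1] -/
theorem rangeIntertwining_toSubmodule :
    (rangeIntertwining χ₁ χ₂).toSubmodule = LinearMap.range (intertwining χ₁ χ₂) := rfl

end Intertwiner

end GL2

end Literature.RepresentationTheory.FiniteGroups

end
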